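import Summits.AtomisticToContinuum.HydrodynamicLimit.Theorems.InformationPercolationEnginePercolationClosesChaosForecastTransferW
import Summits.AtomisticToContinuum.HydrodynamicLimit.Theorems.InformationPercolationEnginePercolationClosesChaosCesaroLocalEquilibriumW
import Summits.AtomisticToContinuum.HydrodynamicLimit.Theorems.InformationPercolationEnginePercolationClosesChaosAtomCollisionDictionary
import Summits.AtomisticToContinuum.HydrodynamicLimit.Theorems.InformationPercolationEnginePercolationClosesChaosDockingR
import HarnessLib

/-!
# Crux `InformationPercolationEngine.PercolationClosesChaos` modulo its six typed inputs (line `equilibrium-forecast-chain-rule`)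

Support file (`--supports stmt-AtomisticToContinuum-15178`) of the line lead (seat c5). The line
`Cruxes/PercolationClosesChaos/Lines/equilibrium_forecast_chain_rule.lean` (skeleton v9.1/v10) kernel-reduces the crux
`KickFairRelEquilibriumMeso → SpectralContractionR → ContactChaos` to SIX typed statements, all of namespace
`Theorems.EquilibriumForecastLine`:

* two EVERY-RATE large-deviation statements about the INVARIANT law `G_N` (crux-class, handed back `promote-stub`):
  `MesoForecastChaosB` (good weighty kinetic units have a bad `G_N`-forecast of their one-step collision statistics only
  LD-rarely) and `MesoStaticMaxwellRarityW` (collision-weighted non-Maxwellian populated regular cells are LD-rare) —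
  texts in `…ForecastRobustDefs` §R3;
* four a-priori statements about the EVOLVED local Gibbs law (item-class, to be filed): `LocalCountUI` (local uniform
  integrability of kinetic collision counts + packing cap), `NoKineticIrregularityB` (no kinetic-scale velocity
  inhomogeneity / rarefaction of occupied cells), `NoMesoscopicOscillationR` (no oscillation between the kinetic cell and
  the target's `r`-ball), `RoughCollisionRare` (grazing / fast / untame owned collisions are rare).

Until now that reduction lived only in the `sorry`-carrying skeleton. This file lands it as SORRY-FREE TREE THEOREMS with the
six statements as antecedents, so that (i) the reduction is kernel-checked and importable, (ii) the moment the planner files the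
six statements as items and they acquire `_holds` witnesses, the crux closes by the one-liner
`percolationClosesChaos_of_inputs h₁ h₂ h₃ h₄ h₅ h₆`, and (iii) the variant `percolationClosesChaos_of_coarseLocalMaxwellianityW`
records the shortcut of ITEMS-v9 §7: the collision-weighted local Maxwellianity of the evolved law `CoarseLocalMaxwellianityW`
may be filed DIRECTLY in place of `MesoStaticMaxwellRarityW` (it is what the transfer consumes; inside the line it is derived
from `MesoStaticMaxwellRarityW` by `stub_cesaroW`, p155628).

Everything used is a landed theorem of the line: `stub_forecastTransferW` (S6, p157027, over the weighted architecture
`kineticCellChaosLG_of_w` p154660), `stub_cesaroW` (S5, p155628), `revealedDefectStability_of_atomCollisionDictionary` (S8 mod S8a,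
p146207) with `stub_atomCollisionDictionary` (S8b, p149815), `stub_dockingR` (S7, p143824). The crux's two hypotheses are not
consumed (Disproof §1 `crux_of_contactChaos`, F16: `SpectralContractionR` is proved and formally decorative; the LG-vs-`G_N`
content of `KickFairRelEquilibriumMeso` is replaced by the chain-rule lever `PredictableProjection`, a theorem, p124443).
-/

namespace Summit.AtomisticToContinuum.HydrodynamicLimit.Theorems.EquilibriumForecastLine

open Summit.AtomisticToContinuum.HydrodynamicLimit.Theses.InformationPercolationEngine

/-- **The route TARGET modulo the six inputs of the line.** `ContactChaos` (averaged molecular chaos at contact at fixed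
reduced density) follows from the two every-rate `G_N`-large-deviation statements `MesoForecastChaosB`,
`MesoStaticMaxwellRarityW` and the four LG-side a-priori inputs `LocalCountUI`, `NoKineticIrregularityB`,
`NoMesoscopicOscillationR`, `RoughCollisionRare` — the composition of skeleton v9.1: weighted Cesàro local equilibrium (S5)
feeds the weighted forecast transfer (S6) together with revealed-defect stability (S8 = S8a + the deterministic dictionary S8b),
whose output `KineticCellChaosLG` docks (S7) with `NoMesoscopicOscillationR` and `LocalCountUI`. [folklore] -/
theorem contactChaos_of_inputs (h₁ : MesoForecastChaosB) (h₂ : MesoStaticMaxwellRarityW) (h₃ : LocalCountUI)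
    (h₄ : NoKineticIrregularityB) (h₅ : NoMesoscopicOscillationR) (h₆ : RoughCollisionRare) : ContactChaos :=
  stub_dockingR
    (stub_forecastTransferW h₁ h₃ h₄ (stub_cesaroW h₂ h₃ h₄)
      (revealedDefectStability_of_atomCollisionDictionary h₆ stub_atomCollisionDictionary))
    h₅ h₃

/-- **The crux modulo the six inputs of the line** (concluded BY NAME): `MesoForecastChaosB → MesoStaticMaxwellRarityW →
LocalCountUI → NoKineticIrregularityB → NoMesoscopicOscillationR → RoughCollisionRare → PercolationClosesChaos`. The two
hypotheses of the crux are discarded (Disproof §1 / F16). [folklore] -/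
theorem percolationClosesChaos_of_inputs : MesoForecastChaosB → MesoStaticMaxwellRarityW → LocalCountUI → NoKineticIrregularityB → NoMesoscopicOscillationR → RoughCollisionRare → PercolationClosesChaos :=
  fun h₁ h₂ h₃ h₄ h₅ h₆ _ _ => contactChaos_of_inputs h₁ h₂ h₃ h₄ h₅ h₆

/-- **Variant through the collision-weighted local Maxwellianity of the evolved law** (ITEMS-v9 §7): if
`CoarseLocalMaxwellianityW` is filed directly (an LG-side a-priori statement of hydrodynamic-limit class), the crux needs only ONE
every-rate `G_N`-large-deviation input, `MesoForecastChaosB`. [folklore] -/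
theorem contactChaos_of_coarseLocalMaxwellianityW (h₁ : MesoForecastChaosB) (h₂ : CoarseLocalMaxwellianityW)
    (h₃ : LocalCountUI) (h₄ : NoKineticIrregularityB) (h₅ : NoMesoscopicOscillationR) (h₆ : RoughCollisionRare) :
    ContactChaos :=
  stub_dockingR
    (stub_forecastTransferW h₁ h₃ h₄ h₂
      (revealedDefectStability_of_atomCollisionDictionary h₆ stub_atomCollisionDictionary))
    h₅ h₃

/-- **The crux through `CoarseLocalMaxwellianityW`** (concluded BY NAME): `MesoForecastChaosB → CoarseLocalMaxwellianityW →
LocalCountUI → NoKineticIrregularityB → NoMesoscopicOscillationR → RoughCollisionRare → PercolationClosesChaos`. [folklore] -/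
theorem percolationClosesChaos_of_coarseLocalMaxwellianityW : MesoForecastChaosB → CoarseLocalMaxwellianityW → LocalCountUI → NoKineticIrregularityB → NoMesoscopicOscillationR → RoughCollisionRare → PercolationClosesChaos :=
  fun h₁ h₂ h₃ h₄ h₅ h₆ _ _ => contactChaos_of_coarseLocalMaxwellianityW h₁ h₂ h₃ h₄ h₅ h₆

/-- **The kinetic-cell output of the line modulo its inputs** (the engine's output before docking, recorded for consumers
that dock differently): `KineticCellChaosLG` from `MesoForecastChaosB`, `MesoStaticMaxwellRarityW`, `LocalCountUI`,
`NoKineticIrregularityB`, `RoughCollisionRare` (no `NoMesoscopicOscillationR`, which only the docking consumes). [folklore] -/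
theorem kineticCellChaosLG_of_inputs (h₁ : MesoForecastChaosB) (h₂ : MesoStaticMaxwellRarityW) (h₃ : LocalCountUI)
    (h₄ : NoKineticIrregularityB) (h₆ : RoughCollisionRare) : KineticCellChaosLG :=
  stub_forecastTransferW h₁ h₃ h₄ (stub_cesaroW h₂ h₃ h₄)
    (revealedDefectStability_of_atomCollisionDictionary h₆ stub_atomCollisionDictionary)

end Summit.AtomisticToContinuum.HydrodynamicLimit.Theorems.EquilibriumForecastLine
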